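import Mathlib
import Summits.ValiantsHypothesis.ValiantsHypothesis.Theorems.ZeroOneTransfer.Negative.TopComponentFree
import Literature.Computability.AlgebraicComplexity.ArithCircuitProofs
import Literature.Computability.AlgebraicComplexity.PermanentIrreducible

/-!
# `DivisionGap.PerMultiplesHard` (stmt-ValiantsHypothesis-5068), line `uncharged-face-walk`:
the free torus normal form of a multiplier (stub `stub_torus`)

For every nonzero `h ∈ ℝ≥0[x_ij]` (`n × n` variables) there are an exponent `g` and a nonzero
`h'` with

* `h'` **torus-homogeneous**: all monomials of `h'` have the same row margins `r` and the same
  column margins `cc`;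
* `h'` **content-free**: every cell `e` is missed by some monomial of `h'` (no variable divides
  `h'`);
* `L⁺(per_n · x^g · h') ≤ L⁺(per_n · h)` for the tree's monotone fan-in-two `complexity` over `ℝ≥0`.

Mechanism.  Over `ℝ≥0` top `w`-components are free (`complexity_topComponent_le`) and
multiplicative (`topComponent_mul`), and `per_n` is homogeneous for each of the `2n` row/column
indicator weights, so `top_w (per · h) = per · top_w h`; iterating over the `2n` weights
(`List.foldr topComponent`) gives a torus-homogeneous `h₁ ≠ 0` with `L⁺(per · h₁) ≤ L⁺(per · h)`.
Then `g :=` the pointwise minimum of `supp h₁` (a `Finset.inf'` in the lattice of exponents) and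
`h' := h₁ /ᵐ g` (Mathlib `MvPolynomial.divMonomial`) satisfy `h₁ = x^g · h'` exactly, and the
minimum is attained in every coordinate, which is content-freeness.

Log (stub-worker): TopForms module (`PerMultiplesHard.Negative.TopForms`, `multiTop`) was unbuilt
on the farm at the time of writing, so the iteration over weights is redone here on top of the
`TopComponentFree` API (`foldr_topComponent_ne_zero`, `isWeightedHomogeneous_foldr_topComponent`,
`complexity_mul_foldr_topComponent_le`); row/column homogeneity of `per_n` is adapted from
`Cruxes/PerMultiplesHard/Disproof.lean` (`isWeightedHomogeneous_perPoly_row/col`). [folklore]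
-/

noncomputable section

open MvPolynomial Literature.Computability.AlgebraicComplexity
open scoped NNReal BigOperators
open Summit.ValiantsHypothesis.ValiantsHypothesis.Theorems.ZeroOneTransfer.Negative

namespace Summit.ValiantsHypothesis.ValiantsHypothesis.Theorems.DivisionGap.PerMultiplesHard.Torus

variable {σ : Type*}

/-! ### Iterated top components over a list of weights -/

/-- Homogeneity for any other weight is inherited by top components (the support shrinks).
[folklore] -/
theorem isWeightedHomogeneous_topComponent_of (w : σ → ℕ) {w' : σ → ℕ}
    {p : MvPolynomial σ ℝ≥0} {m : ℕ} (hp : IsWeightedHomogeneous w' p m) :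
    IsWeightedHomogeneous w' (topComponent w p) m := by
  intro d hd
  rw [coeff_topComponent] at hd
  split_ifs at hd with h
  · exact hp hd
  · exact absurd rfl hd

/-- The top component is weighted homogeneous (of the top degree) for its own weight.
[folklore] -/
theorem isWeightedHomogeneous_topComponent (w : σ → ℕ) (p : MvPolynomial σ ℝ≥0) :
    IsWeightedHomogeneous w (topComponent w p) (weightedTotalDegree w p) :=
  weightedHomogeneousComponent_isWeightedHomogeneous _ _

/-- Iterated top components of a nonzero polynomial are nonzero. [folklore] -/
theorem foldr_topComponent_ne_zero (ws : List (σ → ℕ)) {h : MvPolynomial σ ℝ≥0} (hh : h ≠ 0) :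
    ws.foldr topComponent h ≠ 0 := by
  induction ws with
  | nil => exact hh
  | cons w ws ih =>
    rw [List.foldr_cons]
    exact topComponent_ne_zero w ih

/-- Iterated top components are homogeneous for every weight of the list. [folklore] -/
theorem isWeightedHomogeneous_foldr_topComponent (ws : List (σ → ℕ)) (h : MvPolynomial σ ℝ≥0)
    {w : σ → ℕ} (hw : w ∈ ws) : ∃ m, IsWeightedHomogeneous w (ws.foldr topComponent h) m := by
  induction ws with
  | nil => simp at hw
  | cons w₀ ws ih =>
    rw [List.foldr_cons]
    rcases List.mem_cons.1 hw with rfl | hw'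
    · exact ⟨_, isWeightedHomogeneous_topComponent w _⟩
    · obtain ⟨m, hm⟩ := ih hw'
      exact ⟨m, isWeightedHomogeneous_topComponent_of w₀ hm⟩

/-- Multiplying by a polynomial that is homogeneous for every weight of the list commutes with
iterated top components, at no cost: `L⁺(f · T_ws h) ≤ L⁺(f · h)`. [folklore] -/
theorem complexity_mul_foldr_topComponent_le (ws : List (σ → ℕ)) (f h : MvPolynomial σ ℝ≥0)
    (hf : ∀ w ∈ ws, ∃ m, IsWeightedHomogeneous w f m) :
    complexity (f * ws.foldr topComponent h) ≤ complexity (f * h) := by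
  induction ws with
  | nil => exact le_rfl
  | cons w₀ ws ih =>
    have hf' : ∀ w ∈ ws, ∃ m, IsWeightedHomogeneous w f m :=
      fun w hw => hf w (List.mem_cons_of_mem _ hw)
    obtain ⟨m, hm⟩ := hf w₀ List.mem_cons_self
    have key : f * topComponent w₀ (ws.foldr topComponent h) =
        topComponent w₀ (f * ws.foldr topComponent h) := by
      rw [topComponent_mul, topComponent_eq_self_of_isWeightedHomogeneous w₀ hm]
    rw [List.foldr_cons, key]
    exact (complexity_topComponent_le w₀ _).trans (ih hf')

/-! ### The permanent is homogeneous for the row and column indicator weights -/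

variable {n : ℕ}

-- adapted from Cruxes/PerMultiplesHard/Disproof.lean (`weight_rowWeight_eq_mapDomain`)
/-- Row indicator weights compute row margins. [folklore] -/
theorem weight_rowIndicator (i : Fin n) (d : Fin n × Fin n →₀ ℕ) :
    Finsupp.weight (fun v : Fin n × Fin n => if v.1 = i then 1 else 0) d = ∑ j, d (i, j) := by
  rw [Finsupp.weight_apply, Finsupp.sum_fintype _ _ (fun _ => by simp), Fintype.sum_prod_type,
    Finset.sum_eq_single_of_mem i (Finset.mem_univ i)]
  · simp
  · intro a _ ha
    simp [ha]

/-- Column indicator weights compute column margins. [folklore] -/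
theorem weight_colIndicator (j : Fin n) (d : Fin n × Fin n →₀ ℕ) :
    Finsupp.weight (fun v : Fin n × Fin n => if v.2 = j then 1 else 0) d = ∑ i, d (i, j) := by
  rw [Finsupp.weight_apply, Finsupp.sum_fintype _ _ (fun _ => by simp),
    Fintype.sum_prod_type_right, Finset.sum_eq_single_of_mem j (Finset.mem_univ j)]
  · simp
  · intro b _ hb
    simp [hb]

-- adapted from Cruxes/PerMultiplesHard/Disproof.lean (`isWeightedHomogeneous_perPoly_row`)
/-- The permanent takes exactly one variable from each row: it is homogeneous of degree `1` for
every row indicator weight. [folklore] -/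
theorem isWeightedHomogeneous_perPoly_row (i : Fin n) :
    IsWeightedHomogeneous (fun v : Fin n × Fin n => if v.1 = i then 1 else 0)
      (perPoly (Fin n) ℝ≥0) 1 := by
  intro d hd
  obtain ⟨ρ, rfl⟩ := exists_permMonomial_eq_of_coeff_perPoly_ne_zero ℝ≥0 hd
  rw [weight_rowIndicator]
  exact rowCount_permMonomial ρ i

-- adapted from Cruxes/PerMultiplesHard/Disproof.lean (`isWeightedHomogeneous_perPoly_col`)
/-- The permanent takes exactly one variable from each column: it is homogeneous of degree `1`
for every column indicator weight. [folklore] -/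
theorem isWeightedHomogeneous_perPoly_col (j : Fin n) :
    IsWeightedHomogeneous (fun v : Fin n × Fin n => if v.2 = j then 1 else 0)
      (perPoly (Fin n) ℝ≥0) 1 := by
  intro d hd
  obtain ⟨ρ, rfl⟩ := exists_permMonomial_eq_of_coeff_perPoly_ne_zero ℝ≥0 hd
  rw [weight_colIndicator]
  exact colCount_permMonomial ρ j

/-! ### Step 1: torus-homogeneous multipliers at no cost -/

-- adapted from Cruxes/PerMultiplesHard/Disproof.lean (`exists_multihomogeneous_multiple_le`)
/-- **WLOG the multiplier is torus-homogeneous, for free.** For every nonzero `h` there is a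
nonzero `h₁` all of whose monomials have the same row margins and the same column margins, with
`L⁺(per_n · h₁) ≤ L⁺(per_n · h)`: iterate top components over the `2n` row/column indicator
weights, for each of which `per_n` is homogeneous. [folklore] -/
theorem exists_torus_multiple_le (h : MvPolynomial (Fin n × Fin n) ℝ≥0) (hh : h ≠ 0) :
    ∃ h₁ : MvPolynomial (Fin n × Fin n) ℝ≥0, h₁ ≠ 0 ∧
      (∀ i, ∀ d₁ ∈ h₁.support, ∀ d₂ ∈ h₁.support, ∑ j, d₁ (i, j) = ∑ j, d₂ (i, j)) ∧
      (∀ j, ∀ d₁ ∈ h₁.support, ∀ d₂ ∈ h₁.support, ∑ i, d₁ (i, j) = ∑ i, d₂ (i, j)) ∧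
      complexity (perPoly (Fin n) ℝ≥0 * h₁) ≤ complexity (perPoly (Fin n) ℝ≥0 * h) := by
  classical
  let ws : List (Fin n × Fin n → ℕ) :=
    (List.finRange n).map (fun i v => if v.1 = i then 1 else 0) ++
      (List.finRange n).map (fun j v => if v.2 = j then 1 else 0)
  have hrow_mem : ∀ i : Fin n, (fun v : Fin n × Fin n => if v.1 = i then 1 else 0) ∈ ws :=
    fun i => List.mem_append_left _ (List.mem_map.2 ⟨i, List.mem_finRange i, rfl⟩)
  have hcol_mem : ∀ j : Fin n, (fun v : Fin n × Fin n => if v.2 = j then 1 else 0) ∈ ws :=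
    fun j => List.mem_append_right _ (List.mem_map.2 ⟨j, List.mem_finRange j, rfl⟩)
  refine ⟨ws.foldr topComponent h, foldr_topComponent_ne_zero ws hh, ?_, ?_, ?_⟩
  · intro i d₁ hd₁ d₂ hd₂
    obtain ⟨m, hm⟩ := isWeightedHomogeneous_foldr_topComponent ws h (hrow_mem i)
    rw [← weight_rowIndicator i d₁, ← weight_rowIndicator i d₂, hm (mem_support_iff.1 hd₁),
      hm (mem_support_iff.1 hd₂)]
  · intro j d₁ hd₁ d₂ hd₂
    obtain ⟨m, hm⟩ := isWeightedHomogeneous_foldr_topComponent ws h (hcol_mem j)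
    rw [← weight_colIndicator j d₁, ← weight_colIndicator j d₂, hm (mem_support_iff.1 hd₁),
      hm (mem_support_iff.1 hd₂)]
  · refine complexity_mul_foldr_topComponent_le ws _ h fun w hw => ?_
    rcases List.mem_append.1 hw with hw' | hw'
    · obtain ⟨i, -, rfl⟩ := List.mem_map.1 hw'
      exact ⟨1, isWeightedHomogeneous_perPoly_row i⟩
    · obtain ⟨j, -, rfl⟩ := List.mem_map.1 hw'
      exact ⟨1, isWeightedHomogeneous_perPoly_col j⟩

/-! ### Step 2: divide out the pointwise-minimum monomial -/

/-- **Dividing out the content.** A nonzero torus-homogeneous `h₁` factors EXACTLY as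
`x^g · h'` with `g` the pointwise minimum of its exponents, `h' = h₁ /ᵐ g` nonzero,
torus-homogeneous (margins shifted by those of `g`) and content-free (the minimum is attained in
every coordinate). [folklore] -/
theorem exists_divide_content (h₁ : MvPolynomial (Fin n × Fin n) ℝ≥0) (h₁0 : h₁ ≠ 0)
    (hrow : ∀ i, ∀ d₁ ∈ h₁.support, ∀ d₂ ∈ h₁.support, ∑ j, d₁ (i, j) = ∑ j, d₂ (i, j))
    (hcol : ∀ j, ∀ d₁ ∈ h₁.support, ∀ d₂ ∈ h₁.support, ∑ i, d₁ (i, j) = ∑ i, d₂ (i, j)) :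
    ∃ (g : (Fin n × Fin n) →₀ ℕ) (h' : MvPolynomial (Fin n × Fin n) ℝ≥0), h' ≠ 0 ∧
      (∃ r cc : Fin n → ℕ, ∀ m ∈ h'.support,
        (∀ i, ∑ j, m (i, j) = r i) ∧ (∀ j, ∑ i, m (i, j) = cc j)) ∧
      (∀ e : Fin n × Fin n, ∃ m ∈ h'.support, m e = 0) ∧
      monomial g (1 : ℝ≥0) * h' = h₁ := by
  classical
  have hne : h₁.support.Nonempty := support_nonempty.2 h₁0
  -- the pointwise minimum of the exponents of `h₁`
  set g : (Fin n × Fin n) →₀ ℕ := h₁.support.inf' hne id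
  have hgle : ∀ m ∈ h₁.support, g ≤ m := fun m hm => Finset.inf'_le id hm
  have hgat : ∀ e, ∃ m ∈ h₁.support, g e = m e := by
    intro e
    obtain ⟨m, hm, hme⟩ :=
      Finset.exists_mem_eq_inf' hne (fun d : (Fin n × Fin n) →₀ ℕ => d e)
    refine ⟨m, hm, Eq.trans ?_ hme⟩
    exact Finset.apply_inf'_eq_inf'_comp hne (f := id) (fun d : (Fin n × Fin n) →₀ ℕ => d e)
      (fun x y => Finsupp.inf_apply x y e)
  -- the quotient `h' = h₁ /ᵐ g`; the remainder vanishes since `g ≤` every exponent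
  set h' : MvPolynomial (Fin n × Fin n) ℝ≥0 := h₁.divMonomial g with hh'
  have hsupp : ∀ m, m ∈ h'.support ↔ g + m ∈ h₁.support := fun m => by
    rw [mem_support_iff, mem_support_iff, hh', coeff_divMonomial]
  have hmod : h₁.modMonomial g = 0 := by
    refine MvPolynomial.ext _ _ fun m => ?_
    rw [coeff_zero]
    by_cases hm : g ≤ m
    · exact coeff_modMonomial_of_le h₁ hm
    · rw [coeff_modMonomial_of_not_le h₁ hm]
      by_contra hc
      exact hm (hgle m (mem_support_iff.2 hc))
  have hfac : monomial g (1 : ℝ≥0) * h' = h₁ := by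
    have key := divMonomial_add_modMonomial h₁ g
    rwa [hmod, add_zero] at key
  have h'0 : h' ≠ 0 := by
    intro h0
    apply h₁0
    rw [← hfac, h0, mul_zero]
  refine ⟨g, h', h'0, ?_, ?_, hfac⟩
  · -- torus homogeneity of `h'`: compare with a fixed exponent `m₀` of `h'`
    obtain ⟨m₀, hm₀⟩ := support_nonempty.2 h'0
    refine ⟨fun i => ∑ j, m₀ (i, j), fun j => ∑ i, m₀ (i, j),
      fun m hm => ⟨fun i => ?_, fun j => ?_⟩⟩
    · have key := hrow i (g + m) ((hsupp m).1 hm) (g + m₀) ((hsupp m₀).1 hm₀)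
      simp only [Finsupp.coe_add, Pi.add_apply, Finset.sum_add_distrib] at key
      exact add_left_cancel key
    · have key := hcol j (g + m) ((hsupp m).1 hm) (g + m₀) ((hsupp m₀).1 hm₀)
      simp only [Finsupp.coe_add, Pi.add_apply, Finset.sum_add_distrib] at key
      exact add_left_cancel key
  · -- content-free: the minimum is attained in every coordinate
    intro e
    obtain ⟨m, hm, hme⟩ := hgat e
    refine ⟨m - g, ?_, ?_⟩
    · rw [hsupp, add_tsub_cancel_of_le (hgle m hm)]
      exact hm
    · rw [Finsupp.tsub_apply]
      omega

/-! ### The stub -/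

/-- **Free torus normal form of a multiplier** (stub `stub_torus` of line `uncharged-face-walk`):
for every nonzero `h` there are an exponent `g` and a nonzero torus-homogeneous, content-free `h'`
with `L⁺(per_n · x^g · h') ≤ L⁺(per_n · h)` — free iterated top components over the `2n`
row/column weights, then division by the pointwise-minimum monomial. [folklore] -/
theorem stub_torus (n : ℕ) (h : MvPolynomial (Fin n × Fin n) ℝ≥0) (hh : h ≠ 0) :
    ∃ (g : (Fin n × Fin n) →₀ ℕ) (h' : MvPolynomial (Fin n × Fin n) ℝ≥0), h' ≠ 0 ∧
      (∃ r cc : Fin n → ℕ, ∀ m ∈ h'.support,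
        (∀ i, ∑ j, m (i, j) = r i) ∧ (∀ j, ∑ i, m (i, j) = cc j)) ∧
      (∀ e : Fin n × Fin n, ∃ m ∈ h'.support, m e = 0) ∧
      complexity (perPoly (Fin n) ℝ≥0 * (monomial g (1 : ℝ≥0) * h')) ≤
        complexity (perPoly (Fin n) ℝ≥0 * h) := by
  obtain ⟨h₁, h₁0, hrow, hcol, hL⟩ := exists_torus_multiple_le h hh
  obtain ⟨g, h', h'0, htor, hcf, hfac⟩ := exists_divide_content h₁ h₁0 hrow hcol
  exact ⟨g, h', h'0, htor, hcf, by rw [hfac]; exact hL⟩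

end Summit.ValiantsHypothesis.ValiantsHypothesis.Theorems.DivisionGap.PerMultiplesHard.Torus

end
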